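import Summits.BirchSwinnertonDyer.Rank1Residual.GaloisImage.KolyvaginDerivativeDescent
import Summits.BirchSwinnertonDyer.Rank1Residual.GaloisImage.ContinuousCorestrictionMackey
import Summits.BirchSwinnertonDyer.Rank1Residual.GaloisImage.ContinuousCorestrictionGalois
import HarnessLib

/-!
# Kolyvagin's derivative classes are norm-compatible in the `K_∞`-direction:
# `Cor_{K_i/K} κ_{i,r} = κ_{⊥,r}` — file 2 of row T-DER-BN ([Rubin00] §4.4; the `cores_p` half of
# THEOREM B at the bad places)
# (cell `b2b-bsdres`, team n1011, seat p15 GEN 6; skeleton `cells/n1011/skel/T-DER-BN.md` §1 (S1)–(S2))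

HONEST FRAMING (cell `b2b-bsdres`, run/shared/lean/b2b/bsd-rank1-residual/, verbatim in every
file): the goal of the cell is to DELETE the COMBINATION-SHAPED residual classes of the
Birch–Swinnerton-Dyer formula for ALL analytic-rank `≤ 1` elliptic curves over `ℚ` — "full BSD
formula for every rank `≤ 1` curve in class `C`" assembled STRICTLY from published theorems — so
that the rank-`≤ 1` remainder becomes exactly the CONSTRUCTION-SHAPED classes, which are TYPED
(missing-input `Prop`s), NOT attempted. This is not "finishing BSD". Team n1011 (N10 / N11, the
additive block X4 ∧ `p = 3`): research route on the CONSTRUCTION-SHAPED class X4; no claim beyond the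
stated classes; nothing is booked. TOOL theorems (no definition, no named fact, no `sorry`);
curve-free and coefficient-ring-free.

## What

Data as in THEOREM A (F3b `conjMap_deriv_eq`, F4 `existsUnique_res_eq_deriv`): a number field `K`,
levels `L : EulerSystemLevels K ι` (layers `Γ_i = L.pLevel i`, levels
`U_{i,r} = L.level i r = Γ_i ⊓ U_{⊥,r}`), an Euler system `hc : IsEulerSystem L T p c`, a coefficient
map `red : T ⟶ T′`, a squarefree usable `r`, chosen `σ_ℓ, N_ℓ, Fr_ℓ`, and Kolyvagin's derivative
operator `D_r = ∏_{ℓ ∈ r} Σ_{j<N_ℓ} j σ_ℓ^j` on `H¹(U_{i,r}, T′)`.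

* §0 transport of `D_r` along a linear map commuting with each `σ_ℓ`
  (`apply_noncommProd_apply_eq_of_comm`), and the tautological comparison
  `H¹(U, X) ≅ H¹(U.subgroupOf Γ, X|Γ)` (`toSubgroupOf_resLe`, `toSubgroupOf_conjMap`,
  `toSubgroupOf_injective`).
* §1 **THEOREM A3 at layer `i`** (`existsUnique_resLe_eq_deriv`): if the `σ_ℓ` and `Fr_ℓ` lie in
  `Γ_i` and `(T′)^{U_{i,r}} = 0`, there is a unique `κ_i ∈ H¹(Γ_i, T′)` with
  `res_{U_{i,r}} κ_i = D_r (red_* c_{i,r})` — F4's descent (`X^N = 0`) run inside the open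
  subgroup `Γ_i ⊵ U_{i,r}` with F3b's invariance at layer `i`.
* §2 **NORM COMPATIBILITY** (`cores_eq_of_resLe_eq_deriv`): if `K(r)` and `K_i` are linearly
  disjoint over `K` (`hdisj : U_{⊥,r} · Γ_i = Γ_K`), then for every `κ_i ∈ H¹(Γ_i, T′)` with
  `res κ_i = D_r (red_* c_{i,r})`, `Cor_{K_i/K} κ_i` IS the bottom derivative class `κ_r` of F4:
  `res_{U_{⊥,r}} ∘ Cor_{K_i/K} = Cor_{K_i(r)/K(r)} ∘ res_{U_{i,r}}` (one-term double-coset formula,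
  `Mackey.resSubgroup_cores_eq_coresLe_of_forall_exists`), `Cor` commutes with `D_r`
  (`Mackey.coresLe_conjMap`) and with `red_*` (`Mackey.map_coresLe`), and
  `Cor_{K_i(r)/K(r)} c_{i,r} = c_{⊥,r}` is the field `IsEulerSystem.cores_p` — the `K_∞`-direction of
  the Euler system, used here for the first time in the T-DER chain; then A3's uniqueness at `⊥`.
  This is [Rubin00] §4.4's `κ_{[F,r,M]} = Cor_{F′/F} κ_{[F′,r,M]}` for `F ⊂ F′ ⊂ F_∞`, the input of
  THEOREM B at the places `v ∣ N` (skeleton (S3)–(S4), next file): there `κ_r` must be a norm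
  from a layer `K_i` in which the unramified extension `K(r)_w/K_v` has been absorbed.

References: K. Rubin, *Euler Systems* (2000), §4.4 (Def. 4.4.4, Def. 4.4.10) and Thm. 4.5.1;
B. Mazur, K. Rubin, *Kolyvagin systems*, Mem. AMS 799 (2004), Thm. 3.2.4 (hypothesis: `𝒦` contains
the maximal abelian `p`-extension unramified outside `p𝒫`) and App. A; D. Burns, R. Sakamoto,
T. Sano, IMRN (2019), §6.2 Lemma 6.6 / Hypothesis 6.7 / Remark 6.8.
-/

noncomputable section

open CategoryTheory Function Finset Polynomial Field IsDedekindDomain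
open scoped NumberField Classical
open Literature.NumberTheory.GaloisRepresentations
open Literature.NumberTheory.EllipticCurves (subgroupInclusion subgroupInclusion_apply_coe
  subgroupConj subgroupConj_apply_coe)

universe u v w

namespace Summit.BirchSwinnertonDyer.Rank1Residual.GaloisImage

namespace Derivative

/-! ### §0 Transport lemmas -/

section Transport

variable {A : Type v} [CommRing A] {X Y : Type*} [AddCommGroup X] [Module A X] [AddCommGroup Y]
  [Module A Y]

/-- If `f ∘ g_ℓ = g′_ℓ ∘ f` for every `ℓ ∈ s`, then `f` carries `∏_{ℓ ∈ s} g_ℓ` (`Finset.noncommProd`)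
to `∏_{ℓ ∈ s} g′_ℓ` — transport of Kolyvagin's `D_r` along an equivariant linear map. [folklore] -/
theorem apply_noncommProd_apply_eq_of_comm {κ : Type*} (f : X →ₗ[A] Y) {g : κ → Module.End A X}
    {g' : κ → Module.End A Y} (s : Finset κ)
    (comm : (s : Set κ).Pairwise fun a b => Commute (g a) (g b))
    (comm' : (s : Set κ).Pairwise fun a b => Commute (g' a) (g' b))
    (h : ∀ ℓ ∈ s, ∀ v, f (g ℓ v) = g' ℓ (f v)) (v : X) :
    f (s.noncommProd g comm v) = s.noncommProd g' comm' (f v) := by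
  classical
  induction s using Finset.induction_on generalizing v with
  | empty => simp only [noncommProd_empty, Module.End.one_apply]
  | insert a s ha ih =>
    rw [noncommProd_insert_of_notMem _ _ _ _ ha, noncommProd_insert_of_notMem _ _ _ _ ha,
      Module.End.mul_apply, Module.End.mul_apply, h a (mem_insert_self a s),
      ih (comm.mono fun _ hx => mem_insert_of_mem hx) (comm'.mono fun _ hx => mem_insert_of_mem hx)
        (fun ℓ hℓ => h ℓ (mem_insert_of_mem hℓ))]

end Transport

section SubgroupOf

variable {R : Type u} [CommRing R] [TopologicalSpace R]
variable {G : Type v} [Group G] [TopologicalSpace G] [IsTopologicalGroup G]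
variable (X : TopRep.{v} R G) {H H' : Subgroup G} (h : H ≤ H')

/-- The tautological comparison after restriction is restriction inside `H′`:
`toSubgroupOf (res_{H′/H} x) = res_{H′/(H ∩ H′)} x` on `H¹(H′, X)`. [folklore] -/
theorem toSubgroupOf_resLe (x : continuousCohomology 1 (subgroupRep X H')) :
    toSubgroupOf X h 1 (resLe X h 1 x) = resSubgroup (subgroupRep X H') (H.subgroupOf H') 1 x := by
  obtain ⟨φ, rfl⟩ := oneCocycleClass_surjective _ x
  rw [resLe_oneCocycleClass, toSubgroupOf, map_oneCocycleClass, resSubgroup_oneCocycleClass]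
  exact congrArg _ (Subtype.ext (ContinuousMap.ext fun _ => rfl))

/-- The tautological comparison commutes with the action of `g ∈ H′` (`H` normal):
`toSubgroupOf (g · z) = g · toSubgroupOf z`. [folklore] -/
theorem toSubgroupOf_conjMap [H.Normal] (g : H') (z : continuousCohomology 1 (subgroupRep X H)) :
    toSubgroupOf X h 1 (conjMap X H (g : G) 1 z) =
      conjMap (subgroupRep X H') (H.subgroupOf H') g 1 (toSubgroupOf X h 1 z) := by
  obtain ⟨φ, rfl⟩ := oneCocycleClass_surjective _ z
  rw [conjMap_oneCocycleClass, toSubgroupOf, map_oneCocycleClass, map_oneCocycleClass,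
    conjMap_oneCocycleClass]
  refine congrArg _ (Subtype.ext (ContinuousMap.ext fun x => ?_))
  change X.ρ (g : G) (φ.1 (subgroupConj H (g : G) (subgroupOfHom h x))) =
    X.ρ (g : G) (φ.1 (subgroupOfHom h (subgroupConj (H.subgroupOf H') g x)))
  congr 2

/-- The tautological comparison `H¹(H, X) → H¹(H.subgroupOf H′, X|H′)` is injective (the map
`H.subgroupOf H′ → H` is onto: a splitting vector on `H.subgroupOf H′` splits on `H`). [folklore] -/
theorem toSubgroupOf_injective : Function.Injective (toSubgroupOf X h 1) := by
  intro a b hab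
  obtain ⟨φ, rfl⟩ := oneCocycleClass_surjective _ a
  obtain ⟨ψ, rfl⟩ := oneCocycleClass_surjective _ b
  rw [toSubgroupOf, map_oneCocycleClass, map_oneCocycleClass, ← sub_eq_zero, ← oneCocycleClass_sub,
    oneCocycleClass_eq_zero_iff] at hab
  obtain ⟨w, hw⟩ := hab
  rw [← sub_eq_zero, ← oneCocycleClass_sub, oneCocycleClass_eq_zero_iff]
  refine ⟨w, fun n => ?_⟩
  exact hw ⟨⟨n, h n.2⟩, Subgroup.mem_subgroupOf.mpr n.2⟩

end SubgroupOf

/-! ### §1 THEOREM A3 at layer `i`: `κ_i ∈ H¹(Gal(K̄/K_i), T′)` -/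

section Layer

variable {K : Type u} [Field K] [NumberField K] {ι : Type w} [Preorder ι] [OrderBot ι]
variable {A : Type v} [CommRing A] [TopologicalSpace A]
variable {M : Type u} [AddCommGroup M] [Module A M] [TopologicalSpace M] [IsTopologicalAddGroup M]
  [ContinuousSMul A M] [Module.Free A M] [Module.Finite A M]
variable {L : EulerSystemLevels K ι} {T : GaloisRep K A M} {p : ℕ} [Fact p.Prime] [Algebra ℤ_[p] A]
variable {c : ∀ (i : ι) (r : L.Ideals), H1 T (L.level i r.1)}
variable {M' : Type u} [AddCommGroup M'] [Module A M'] [TopologicalSpace M'] [IsTopologicalAddGroup M']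
  [ContinuousSMul A M'] {T' : GaloisRep K A M'}

variable (L) in
/-- `Gal(K̄/K_i(r)) ≤ Gal(K̄/K_i)`. [folklore] -/
theorem level_le_pLevel (i : ι) (r : Finset (HeightOneSpectrum (𝓞 K))) : L.level i r ≤ L.pLevel i :=
  fun _ hg => (L.mem_level_iff.mp hg).1

/-- **THEOREM A3 at layer `i`** ([Rubin00] Def. 4.4.4 over `F = K_i`): with the data and hypotheses
of F3b `conjMap_deriv_eq` at layer `i` (`σ_ℓ, Fr_ℓ ∈ Gal(K̄/K_i)`, levels ramified at `ℓ`, `T′`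
killed by `N_ℓ` and `P_ℓ(1)`) and `(T′)^{Gal(K̄/K_i(r))} = 0` (`h0`), there is a UNIQUE
`κ_i ∈ H¹(Gal(K̄/K_i), T′)` restricting on `Gal(K̄/K_i(r))` to `D_r (red_* c_{i,r})`.  (F4's
`existsUnique_resSubgroup_eq_of_forall_conjMap_eq` for the group `Gal(K̄/K_i)` and its open normal
subgroup `Gal(K̄/K_i(r))`, transported along `toSubgroupOf`.)
[cite: Rubin2000, Def. 4.4.4 and Lemma 4.4.2] -/
theorem existsUnique_resLe_eq_deriv (hc : IsEulerSystem L T p c) (red : T.toTopRep ⟶ T'.toTopRep)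
    (i : ι) (r : L.Ideals)
    (σ : HeightOneSpectrum (𝓞 K) → absoluteGaloisGroup K) (N : HeightOneSpectrum (𝓞 K) → ℕ)
    (Fr : HeightOneSpectrum (𝓞 K) → absoluteGaloisGroup K)
    (hσp : ∀ ℓ ∈ r.1, σ ℓ ∈ L.pLevel i)
    (hσ : ∀ ℓ ∈ r.1, ∀ q ∈ r.1, q ≠ ℓ → σ ℓ ∈ L.tameLevel q)
    (hcov : ∀ ℓ ∈ r.1, ∀ g : absoluteGaloisGroup K, ∃ j < N ℓ, (σ ℓ ^ j)⁻¹ * g ∈ L.tameLevel ℓ)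
    (hinj : ∀ ℓ ∈ r.1, ∀ j₁ < N ℓ, ∀ j₂ < N ℓ, (σ ℓ ^ j₁)⁻¹ * σ ℓ ^ j₂ ∈ L.tameLevel ℓ → j₁ = j₂)
    (hFrp : ∀ ℓ ∈ r.1, Fr ℓ ∈ L.pLevel i) (hFr : ∀ ℓ ∈ r.1, IsArithFrobAtPlace K ℓ (Fr ℓ))
    (hram : ∀ ℓ ∈ r.1, ∀ s ⊆ r.1, ℓ ∉ s → ¬ SubgroupIsUnramifiedAt K (L.level i (insert ℓ s)) ℓ)
    (hM₁ : ∀ ℓ ∈ r.1, ∀ v : M', (N ℓ : A) • v = 0)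
    (hM₂ : ∀ ℓ ∈ r.1, ∀ v : M',
      (rubinEulerFactor T.toRepresentation (cyclotomicCharacterToUnits K p A) (Fr ℓ)).eval 1 • v = 0)
    (comm)
    (h0 : ∀ v : T'.toTopRep, (∀ u : L.level i r.1, T'.toTopRep.ρ (u : absoluteGaloisGroup K) v = v) →
      v = 0) :
    ∃! κ : continuousCohomology 1 (subgroupRep T'.toTopRep (L.pLevel i)),
      resLe T'.toTopRep (level_le_pLevel L i r.1) 1 κ =
        (r.1.noncommProd (fun ℓ => ∑ j ∈ range (N ℓ), (j : Module.End A (continuousCohomology 1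
          (subgroupRep T'.toTopRep (L.level i r.1)))) *
          (conjMap T'.toTopRep (L.level i r.1) (σ ℓ) 1).hom.toLinearMap ^ j) comm)
        (ContinuousCohomology.map (ContinuousMonoidHom.id _) (X := subgroupRep T.toTopRep (L.level i r.1))
          (Y := subgroupRep T'.toTopRep (L.level i r.1))
          ((TopRep.resFunctor (L.level i r.1).subtype).map red) 1 (c i r)) := by
  set y := (r.1.noncommProd (fun ℓ => ∑ j ∈ range (N ℓ), (j : Module.End A (continuousCohomology 1
          (subgroupRep T'.toTopRep (L.level i r.1)))) *
          (conjMap T'.toTopRep (L.level i r.1) (σ ℓ) 1).hom.toLinearMap ^ j) comm)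
        (ContinuousCohomology.map (ContinuousMonoidHom.id _) (X := subgroupRep T.toTopRep (L.level i r.1))
          (Y := subgroupRep T'.toTopRep (L.level i r.1))
          ((TopRep.resFunctor (L.level i r.1).subtype).map red) 1 (c i r)) with hy_def
  have hle : L.level i r.1 ≤ L.pLevel i := level_le_pLevel L i r.1
  -- invariance under `Gal(K̄/K_i)` (THEOREM A2 at layer `i`)
  have hinv : ∀ g ∈ L.pLevel i, conjMap T'.toTopRep (L.level i r.1) g 1 y = y := fun g hg =>
    conjMap_deriv_eq hc red i r σ N Fr hσp hσ hcov hinj hFrp hFr hram hM₁ hM₂ comm g hg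
  -- F4's descent inside the open subgroup `Gal(K̄/K_i)`
  have h0' : ∀ v : subgroupRep T'.toTopRep (L.pLevel i),
      (∀ n : (L.level i r.1).subgroupOf (L.pLevel i),
        (subgroupRep T'.toTopRep (L.pLevel i)).ρ (n : L.pLevel i) v = v) → v = 0 :=
    fun v hv => h0 v fun u => hv ⟨⟨u, hle u.2⟩, Subgroup.mem_subgroupOf.mpr u.2⟩
  have hy' : ∀ g : L.pLevel i, conjMap (subgroupRep T'.toTopRep (L.pLevel i))
      ((L.level i r.1).subgroupOf (L.pLevel i)) g 1 (toSubgroupOf T'.toTopRep hle 1 y) =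
        toSubgroupOf T'.toTopRep hle 1 y := fun g => by
    rw [← toSubgroupOf_conjMap, hinv g g.2]
  obtain ⟨x, hx, huniq⟩ := existsUnique_resSubgroup_eq_of_forall_conjMap_eq
    (subgroupRep T'.toTopRep (L.pLevel i)) ((L.level i r.1).subgroupOf (L.pLevel i))
    (isOpen_subgroupOf (L.pLevel i) (L.isOpen_level i r.1)) h0' _ hy'
  refine ⟨x, ?_, fun x' hx' => huniq x' ?_⟩
  · exact toSubgroupOf_injective T'.toTopRep hle (by rw [toSubgroupOf_resLe, hx])
  · change resSubgroup _ _ 1 x' = toSubgroupOf _ hle 1 y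
    rw [← toSubgroupOf_resLe, hx']

end Layer

/-! ### §2 Norm compatibility `Cor_{K_i/K} κ_i = κ_⊥` -/

section NormCompatible

variable {K : Type u} [Field K] [NumberField K] {ι : Type w} [Preorder ι] [OrderBot ι]
variable {A : Type v} [CommRing A] [TopologicalSpace A]
variable {M : Type u} [AddCommGroup M] [Module A M] [TopologicalSpace M] [IsTopologicalAddGroup M]
  [ContinuousSMul A M] [Module.Free A M] [Module.Finite A M]
variable {L : EulerSystemLevels K ι} {T : GaloisRep K A M} {p : ℕ} [Fact p.Prime] [Algebra ℤ_[p] A]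
variable {c : ∀ (i : ι) (r : L.Ideals), H1 T (L.level i r.1)}
variable {M' : Type u} [AddCommGroup M'] [Module A M'] [TopologicalSpace M'] [IsTopologicalAddGroup M']
  [ContinuousSMul A M'] {T' : GaloisRep K A M'}

/-- **NORM COMPATIBILITY OF THE DERIVATIVE CLASSES** ([Rubin00] §4.4: `κ_{[F,r,M]} = Cor κ_{[F′,r,M]}`
for `F ⊂ F′ ⊂ F_∞`).  With the data and hypotheses of F4 `existsUnique_res_eq_deriv` at the
bottom layer (so that `κ_⊥ = κ_r` is unique), a layer `i` with `K(r) ∩ K_i = K`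
(`hdisj : Gal(K̄/K(r)) · Gal(K̄/K_i) = Γ_K`) and the operator `D_r` at layer `i` built from the SAME
`σ_ℓ` (any commutation proof `comm_i`): every `κ_i ∈ H¹(Gal(K̄/K_i), T′)` with
`res_{K_i(r)} κ_i = D_r (red_* c_{i,r})` (e.g. the class of `existsUnique_resLe_eq_deriv`) has
`Cor_{K_i/K} κ_i = κ` for every `κ ∈ H¹(K, T′)` with `res_{K(r)} κ = D_r (red_* c_{⊥,r})`.
Ingredients: the one-term double-coset formula (`Mackey.resSubgroup_cores_eq_coresLe_of_forall_exists`),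
`Cor ∘ D_r = D_r ∘ Cor` (`Mackey.coresLe_conjMap`), `Cor ∘ red_* = red_* ∘ Cor`
(`Mackey.map_coresLe`), the Euler-system field `IsEulerSystem.cores_p`
(`Cor_{K_i(r)/K(r)} c_{i,r} = c_{⊥,r}`), and A3's uniqueness.
[cite: Rubin2000, §4.4 Def. 4.4.10 and Thm. 4.5.1] [cite: MazurRubin2004, Thm. 3.2.4 and App. A] -/
theorem cores_eq_of_resLe_eq_deriv (hc : IsEulerSystem L T p c) (red : T.toTopRep ⟶ T'.toTopRep)
    (i : ι) [Fintype (absoluteGaloisGroup K ⧸ L.pLevel i)] (r : L.Ideals)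
    (σ : HeightOneSpectrum (𝓞 K) → absoluteGaloisGroup K) (N : HeightOneSpectrum (𝓞 K) → ℕ)
    (Fr : HeightOneSpectrum (𝓞 K) → absoluteGaloisGroup K)
    (hσ : ∀ ℓ ∈ r.1, ∀ q ∈ r.1, q ≠ ℓ → σ ℓ ∈ L.tameLevel q)
    (hcov : ∀ ℓ ∈ r.1, ∀ g : absoluteGaloisGroup K, ∃ j < N ℓ, (σ ℓ ^ j)⁻¹ * g ∈ L.tameLevel ℓ)
    (hinj : ∀ ℓ ∈ r.1, ∀ j₁ < N ℓ, ∀ j₂ < N ℓ, (σ ℓ ^ j₁)⁻¹ * σ ℓ ^ j₂ ∈ L.tameLevel ℓ → j₁ = j₂)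
    (hFr : ∀ ℓ ∈ r.1, IsArithFrobAtPlace K ℓ (Fr ℓ))
    (hram : ∀ ℓ ∈ r.1, ∀ s ⊆ r.1, ℓ ∉ s → ¬ SubgroupIsUnramifiedAt K (L.level ⊥ (insert ℓ s)) ℓ)
    (hM₁ : ∀ ℓ ∈ r.1, ∀ v : M', (N ℓ : A) • v = 0)
    (hM₂ : ∀ ℓ ∈ r.1, ∀ v : M',
      (rubinEulerFactor T.toRepresentation (cyclotomicCharacterToUnits K p A) (Fr ℓ)).eval 1 • v = 0)
    (comm)
    (h0 : ∀ v : T'.toTopRep, (∀ u : L.level ⊥ r.1, T'.toTopRep.ρ (u : absoluteGaloisGroup K) v = v) →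
      v = 0)
    (hdisj : ∀ g : absoluteGaloisGroup K, ∃ u : L.level ⊥ r.1,
      (u : absoluteGaloisGroup K)⁻¹ * g ∈ L.pLevel i)
    (comm_i)
    (κi : continuousCohomology 1 (subgroupRep T'.toTopRep (L.pLevel i)))
    (hκi : resLe T'.toTopRep (level_le_pLevel L i r.1) 1 κi =
        (r.1.noncommProd (fun ℓ => ∑ j ∈ range (N ℓ), (j : Module.End A (continuousCohomology 1
          (subgroupRep T'.toTopRep (L.level i r.1)))) *
          (conjMap T'.toTopRep (L.level i r.1) (σ ℓ) 1).hom.toLinearMap ^ j) comm_i)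
        (ContinuousCohomology.map (ContinuousMonoidHom.id _) (X := subgroupRep T.toTopRep (L.level i r.1))
          (Y := subgroupRep T'.toTopRep (L.level i r.1))
          ((TopRep.resFunctor (L.level i r.1).subtype).map red) 1 (c i r)))
    (κ : continuousCohomology 1 T'.toTopRep)
    (hκ : resSubgroup T'.toTopRep (L.level ⊥ r.1) 1 κ =
        (r.1.noncommProd (fun ℓ => ∑ j ∈ range (N ℓ), (j : Module.End A (continuousCohomology 1
          (subgroupRep T'.toTopRep (L.level ⊥ r.1)))) *
          (conjMap T'.toTopRep (L.level ⊥ r.1) (σ ℓ) 1).hom.toLinearMap ^ j) comm)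
        (ContinuousCohomology.map (ContinuousMonoidHom.id _) (X := subgroupRep T.toTopRep (L.level ⊥ r.1))
          (Y := subgroupRep T'.toTopRep (L.level ⊥ r.1))
          ((TopRep.resFunctor (L.level ⊥ r.1).subtype).map red) 1 (c ⊥ r))) :
    cores T'.toTopRep (L.pLevel i) (L.isOpen_pLevel i) κi = κ := by
  classical
  haveI hfin : Fintype (L.level ⊥ r.1 ⧸ (L.level i r.1).subgroupOf (L.level ⊥ r.1)) :=
    Fintype.ofFinite _
  have hii : L.level i r.1 ≤ L.level ⊥ r.1 := L.level_mono_left bot_le r.1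
  have hDN : ∀ g : absoluteGaloisGroup K, g ∈ L.level ⊥ r.1 → g ∈ L.pLevel i → g ∈ L.level i r.1 :=
    fun g hg hgi => L.mem_level_iff.mpr ⟨hgi, (L.mem_level_iff.mp hg).2⟩
  -- uniqueness of `κ_⊥`
  refine (existsUnique_res_eq_deriv hc red r σ N Fr hσ hcov hinj hFr hram hM₁ hM₂ comm h0).unique
    ?_ hκ
  -- `res_{K(r)} ∘ Cor_{K_i/K} = Cor_{K_i(r)/K(r)} ∘ res_{K_i(r)}` (one double coset)
  rw [Mackey.resSubgroup_cores_eq_coresLe_of_forall_exists T'.toTopRep (L.pLevel i) (L.level ⊥ r.1)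
    (L.level i r.1) hii (level_le_pLevel L i r.1) hDN (L.isOpen_pLevel i) (L.isOpen_level i r.1)
    hdisj κi, hκi]
  -- `Cor ∘ D_r = D_r ∘ Cor`
  rw [apply_noncommProd_apply_eq_of_comm (coresLe T'.toTopRep hii (L.isOpen_level i r.1)) r.1 comm_i
    comm (fun ℓ _ v => apply_deriv_apply_eq_of_comm _ (fun w =>
      Mackey.coresLe_conjMap T'.toTopRep hii (L.isOpen_level i r.1) (σ ℓ) w) (N ℓ) v)]
  -- `Cor ∘ red_* = red_* ∘ Cor` and `Cor c_{i,r} = c_{⊥,r}` (`cores_p`)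
  congr 1
  rw [← Mackey.map_coresLe red hii (L.isOpen_level i r.1) (c i r)]
  congr 1
  have hp := hc.cores_p (bot_le : (⊥ : ι) ≤ i) r
  have hinst : hfin = Fintype.ofFinite _ := Subsingleton.elim _ _
  subst hinst
  exact hp

end NormCompatible

end Derivative

end Summit.BirchSwinnertonDyer.Rank1Residual.GaloisImage

end
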